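import Literature.Topology.FourManifolds.HCobordismCancelStep
import Literature.Topology.FourManifolds.HCobordismTheoremProofs
import Literature.Topology.FourManifolds.DisjointSpheresSlab
import Literature.Topology.FourManifolds.PreliminaryRearrangementProofs
import HarnessLib

/-!
# Cancelling a transverse `k/(k+1)` pair of critical points of a nice Morse function on a cobordism

Helper file (lead c1, crux `ConvexBisection.AcyclicBisectionRigidity`, item
stmt-SmoothPoincare4-10507).  The cross-seam levers of the round-2 lines (`stub_seamPairDichotomy`,
`stub_crossCancellation`) conclude by CANCELLING a 1-handle of one half against a dual 2-handle of the
other; with Milnor's First Cancellation Theorem proved in the tree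
(`Cobordism.Milnor1965_firstCancellation_slab_holds`) the cancellation itself is a theorem, and only
the GEOMETRIC DUALITY ("the transported dual meets the belt sphere once, transversely" = Milnor's
Def. 5.1: `S_R(p) ∩ S_L(q)` is one point, transversely, in the intermediate level) remains
conjectural.  This file packages Milnor's Thm. 5.4 in any index, exactly as the tree does for
index `0` (`Cobordism.Milnor1965_cancel_pair_index_zero_of_parts`, `HCobordismCancelStep.lean`,
proof of Thm. 8.1 Index 0 / pattern of PDF p. 57):

* `cancel_pair_of_isTransverseInLevel` — on a cobordism `c = (W; M, N)` with a NICE Morse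
  function `g` (`IsNiceMorseFunction`: the critical points of index `j` on the level
  `niceLevel n j`) and a smooth gradient-like field `ξ`, if `p`, `q` are critical of indices `k`,
  `k + 1` and in Milnor's level `V_{k+} = g⁻¹(plusLevel n k)` the right-hand sphere of `p` and the
  left-hand sphere of `q` meet in a single point, transversely (`IsTransverseInLevel`), then there
  is a nice Morse function `g'` on `c` with critical set `crit g ∖ {p, q}` and the old indices.
  Proof: 4.2 (`Milnor1965_rearrangement_slab`, discharged) raises `p` above the other critical
  points of index `k` and lowers `q` below the other ones of index `k + 1` (same levels, so
  disjoint `K`-sets), without touching `V_{k+}` and the spheres in it; 5.4 on the slab between the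
  new levels of `p` and `q` removes both; 4.8 (`Milnor1965_finalRearrangement_holds`) makes the
  result nice.  All four ingredients are theorems of the tree; no named fact remains.

Everything is proved; no definitions. [cite: MilnorHCobordism1965, Thm. 5.4 (PDF p. 27), Thms. 4.1/4.2 (PDF pp. 22–23), Thm. 4.8 (PDF p. 25); pattern of PDF p. 57]
-/

open scoped Manifold ContDiff Topology
open Set Function Filter

noncomputable section

-- the prescribed namespace `Summit.<P>.<Sub>.…` duplicates `SmoothPoincare4` (P = Sub)
set_option linter.dupNamespace false

namespace Summit.SmoothPoincare4.SmoothPoincare4.Theorems.AcyclicBisectionRigidity.Cancellation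

open Literature.Topology.FourManifolds Literature.Topology.FourManifolds.Cobordism

universe u

/-! ### The slabs around `V_{k+}` contain only critical points of index `k`, `k + 1` -/

/-- The bottom `(k + ¼)/(n + 2)` of the lower slab is positive, below the level of index `k`,
and the only nice level in `[(k + ¼)/(n+2), V_{k+}]` is that of index `k`. [folklore] -/
theorem niceLevel_mem_Icc_lower_iff (n k j : ℕ) :
    niceLevel n j ∈ Icc ((k + 1 / 4) / (n + 2) : ℝ) (plusLevel n k) ↔ j = k := by
  have h : (0 : ℝ) < n + 2 := by positivity
  rw [niceLevel_def, plusLevel_def, mem_Icc, div_le_div_iff_of_pos_right h,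
    div_le_div_iff_of_pos_right h]
  constructor
  · rintro ⟨h1, h2⟩
    have hkj : k ≤ j := by
      by_contra hlt
      have : (j : ℝ) + 1 ≤ k := by exact_mod_cast Nat.lt_of_not_le hlt
      linarith
    have hjk : j ≤ k := by
      by_contra hlt
      have : (k : ℝ) + 1 ≤ j := by exact_mod_cast Nat.lt_of_not_le hlt
      linarith
    exact le_antisymm hjk hkj
  · rintro rfl
    constructor <;> linarith

/-- The only nice level in `[V_{k+}, (L_{k+1} + V_{(k+1)+})/2]` is that of index `k + 1`. [folklore] -/
theorem niceLevel_mem_Icc_upper_iff (n k j : ℕ) :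
    niceLevel n j ∈ Icc (plusLevel n k) ((niceLevel n (k + 1) + plusLevel n (k + 1)) / 2) ↔
      j = k + 1 := by
  have h : (0 : ℝ) < n + 2 := by positivity
  have hmid : (niceLevel n (k + 1) + plusLevel n (k + 1)) / 2 = ((k : ℝ) + 1 + 3 / 4) / (n + 2) := by
    rw [niceLevel_def, plusLevel_def]
    push_cast
    field_simp
    ring
  rw [hmid, niceLevel_def, plusLevel_def, mem_Icc, div_le_div_iff_of_pos_right h,
    div_le_div_iff_of_pos_right h]
  constructor
  · rintro ⟨h1, h2⟩
    have hkj : k + 1 ≤ j := by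
      by_contra hlt
      have : (j : ℝ) ≤ k := by exact_mod_cast Nat.lt_succ_iff.1 (Nat.lt_of_not_le hlt)
      linarith
    have hjk : j ≤ k + 1 := by
      by_contra hlt
      have : (k : ℝ) + 2 ≤ j := by exact_mod_cast Nat.lt_of_not_le hlt
      linarith
    exact le_antisymm hjk hkj
  · rintro rfl
    push_cast
    constructor <;> linarith

/-! ### The cancellation of a transverse pair -/

section Cancel

variable {n : ℕ} {M N : Type u} [TopologicalSpace M] [T2Space M] [SecondCountableTopology M]
  [ChartedSpace (EuclideanSpace ℝ (Fin n)) M] [IsManifold (𝓡 n) ∞ M] [CompactSpace M]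
  [TopologicalSpace N] [T2Space N] [SecondCountableTopology N]
  [ChartedSpace (EuclideanSpace ℝ (Fin n)) N] [IsManifold (𝓡 n) ∞ N] [CompactSpace N]

/-- **Raising one critical point of index `k` above the others** (Milnor 1965, Thm. 4.2 with the
invariant function of 4.1, both discharged in the tree).  For a nice Morse function `g` on a
cobordism, a smooth gradient-like `ξ` and a critical point `p` of index `k ≤ n`, there is a Morse
function `g₁`, still with gradient-like `ξ`, the same critical set and indices and the same level
`V_{k+} = plusLevel n k`, agreeing with `g` at every other critical point, such that `p` is the ONLY
critical point with value in a slab `[a₀, V_{k+}]`, `0 < a₀ < g₁ p < V_{k+}`.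
[cite: MilnorHCobordism1965, Thms. 4.1, 4.2 (PDF pp. 22–23); pattern of PDF p. 57] -/
theorem exists_raise_criticalPoint {c : Cobordism n M N} {g : c.W → ℝ}
    (hg : c.IsNiceMorseFunction g)
    (ξ : Cₛ^∞⟮𝓡∂ (n + 1); EuclideanSpace ℝ (Fin (n + 1)), (TangentSpace (𝓡∂ (n + 1)) : c.W → Type)⟯)
    (hξ : IsGradientLike (𝓡∂ (n + 1)) g ξ) {p : c.W} {k : ℕ} (hkn : k ≤ n)
    (hp : p ∈ criticalSetOfIndex (𝓡∂ (n + 1)) g k) :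
    ∃ g₁ : c.W → ℝ, ∃ a₀ : ℝ, c.IsMorseFunction g₁ ∧ IsGradientLike (𝓡∂ (n + 1)) g₁ ξ ∧
      criticalSet (𝓡∂ (n + 1)) g₁ = criticalSet (𝓡∂ (n + 1)) g ∧
      (∀ z ∈ criticalSet (𝓡∂ (n + 1)) g,
        morseIndex (𝓡∂ (n + 1)) g₁ z = morseIndex (𝓡∂ (n + 1)) g z) ∧
      0 < a₀ ∧ a₀ < g₁ p ∧ g₁ p < plusLevel n k ∧
      (∀ z ∈ criticalSet (𝓡∂ (n + 1)) g₁, z ≠ p → g₁ z ∉ Icc a₀ (plusLevel n k)) ∧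
      (∀ z, g₁ z = plusLevel n k ↔ g z = plusLevel n k) ∧
      (∀ z ∈ criticalSet (𝓡∂ (n + 1)) g, z ≠ p → g₁ z = g z) := by
  have h42 : Cobordism.Milnor1965_rearrangement_slab.{u} :=
    Cobordism.Milnor1965_rearrangement_slab_of_invariantFunction
      Cobordism.Milnor1965_exists_invariantFunction_holds
  -- levels
  have hLkVk : niceLevel n k < plusLevel n k := niceLevel_lt_plusLevel n k
  have hVkL1 : plusLevel n k < niceLevel n (k + 1) := plusLevel_lt_niceLevel_succ n k
  have hL1lt1 : niceLevel n (k + 1) < 1 := niceLevel_lt_one (by omega)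
  have hn2 : (0 : ℝ) < n + 2 := by positivity
  have hVklt1 : plusLevel n k < 1 := hVkL1.trans hL1lt1
  -- the bottom of the lower slab
  set a₁ : ℝ := ((k : ℝ) + 1 / 4) / (n + 2) with ha₁
  have ha₁0 : 0 < a₁ := by rw [ha₁]; positivity
  have ha₁L : a₁ < niceLevel n k := by
    rw [ha₁, niceLevel_def]; exact div_lt_div_of_pos_right (by linarith) hn2
  -- the field is `C¹`; values of the critical points of the nice `g`
  have hv : ContMDiff (𝓡∂ (n + 1)) (𝓡∂ (n + 1)).tangent 1
      (fun y ↦ (⟨y, ξ y⟩ : TangentBundle (𝓡∂ (n + 1)) c.W)) :=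
    ξ.contMDiff.of_le (WithTop.coe_le_coe.mpr le_top)
  have hval : ∀ z ∈ criticalSet (𝓡∂ (n + 1)) g,
      g z = niceLevel n (morseIndex (𝓡∂ (n + 1)) g z) := fun z hz => hg.2 z hz
  have hpc : p ∈ criticalSet (𝓡∂ (n + 1)) g := hp.1
  have hpval : g p = niceLevel n k := by rw [hval p hpc, hp.2]

  -- the other critical points of index `k`
  set P' : Set c.W := criticalSetOfIndex (𝓡∂ (n + 1)) g k \ {p} with hP'
  -- the critical points of `g` in the closed slab `[a₁, V_{k+}]` are `p` and `P'`
  have hslab : ∀ z ∈ criticalSet (𝓡∂ (n + 1)) g,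
      g z ∈ Icc a₁ (plusLevel n k) → z ∈ ({p} ∪ P' : Set c.W) := by
    intro z hz hzI
    have hj : morseIndex (𝓡∂ (n + 1)) g z = k := by
      rw [hval z hz] at hzI
      exact (niceLevel_mem_Icc_lower_iff n k _).1 hzI
    by_cases hzp : z = p
    · exact Or.inl hzp
    · exact Or.inr ⟨⟨hz, hj⟩, hzp⟩
  by_cases hne : P'.Nonempty
  · -- 4.2 with `P = {p}` raised to `aP = (L_k + V_{k+})/2` and `P'` kept at `L_k`
    set aP : ℝ := (niceLevel n k + plusLevel n k) / 2 with haP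
    have haP1 : niceLevel n k < aP := by rw [haP]; linarith
    have haP2 : aP < plusLevel n k := by rw [haP]; linarith
    have hPsub : ({p} ∪ P' : Set c.W) ⊆ criticalSet (𝓡∂ (n + 1)) g := by
      rintro z (hz | hz)
      · rw [mem_singleton_iff.1 hz]; exact hpc
      · exact hz.1.1
    have hdisjP : Disjoint ({p} : Set c.W) P' :=
      disjoint_singleton_left.2 fun h => h.2 rfl
    have hvalP' : ∀ z ∈ P', g z = niceLevel n k := fun z hz => by rw [hval z hz.1.1, hz.1.2]
    have hK : Disjoint (⋃ z ∈ ({p} : Set c.W), trajectorySet (𝓡∂ (n + 1)) ξ z)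
        (⋃ z ∈ P', trajectorySet (𝓡∂ (n + 1)) ξ z) := by
      refine disjoint_iUnion₂_left.2 fun z hz => disjoint_iUnion₂_right.2 fun z' hz' => ?_
      rw [mem_singleton_iff] at hz
      rw [hz]
      exact hξ.disjoint_trajectorySet_of_apply_eq hv
        (hg.1.isMorse.contMDiff.mdifferentiable (by simp)) (fun h => hz'.2 h.symm)
        (hpval.trans (hvalP' z' hz').symm)
    obtain ⟨g₁, hg₁, hξ₁, hcrit₁, hvP, hvP', hnear, hIoo, hlocP, hlocP'⟩ :=
      h42 hg.1 ξ hξ ha₁0 (ha₁L.trans hLkVk) hVklt1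
        (singleton_nonempty p) hne hdisjP hPsub hslab
        (show niceLevel n k ∈ Ioo a₁ (plusLevel n k) from ⟨ha₁L, hLkVk⟩)
        (show niceLevel n k ∈ Ioo a₁ (plusLevel n k) from ⟨ha₁L, hLkVk⟩)
        (fun z hz => by rw [mem_singleton_iff.1 hz, hpval]) hvalP' hK
        ⟨ha₁L.trans haP1, haP2⟩ ⟨ha₁L, hLkVk⟩
    have hout : ∀ z, g z ∉ Ioo a₁ (plusLevel n k) → g₁ z = g z := fun z hz =>
      hnear.self_of_nhdsSet z hz
    have hnear' : ∀ z, g z ∉ Ioo a₁ (plusLevel n k) → g₁ =ᶠ[𝓝 z] g :=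
      fun z hz => hnear.filter_mono (nhds_le_nhdsSet hz)
    refine ⟨g₁, (niceLevel n k + aP) / 2, hg₁, hξ₁, hcrit₁, ?_, ?_, ?_, ?_, ?_, ?_, ?_⟩
    · -- indices
      intro z hz
      by_cases hzs : g z ∈ Icc a₁ (plusLevel n k)
      · rcases hslab z hz hzs with hzp | hzP'
        · rw [mem_singleton_iff] at hzp
          subst hzp
          exact morseIndex_congr_of_eventuallyEq_add_const (hlocP z rfl)
        · exact morseIndex_congr_of_eventuallyEq_add_const (hlocP' z hzP')
      · exact morseIndex_congr_of_eventuallyEq (hnear' z fun h => hzs (Ioo_subset_Icc_self h))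
    · linarith [niceLevel_pos n k]
    · rw [hvP p rfl]; linarith
    · rw [hvP p rfl]; exact haP2
    · -- the other critical points avoid `[a₀, V_{k+}]`
      intro z hz hzp hzI
      rw [hcrit₁] at hz
      by_cases hzs : g z ∈ Icc a₁ (plusLevel n k)
      · rcases hslab z hz hzs with hzp' | hzP'
        · exact hzp (mem_singleton_iff.1 hzp')
        · rw [hvP' z hzP'] at hzI
          linarith [hzI.1]
      · have hzo : g z ∉ Ioo a₁ (plusLevel n k) := fun h => hzs (Ioo_subset_Icc_self h)
        rw [hout z hzo] at hzI
        rw [mem_Icc, not_and_or, not_le, not_le] at hzs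
        rcases hzs with hlt | hlt
        · linarith [hzI.1]
        · linarith [hzI.2]
    · -- the level `V_{k+}` is unchanged
      intro z
      by_cases hzo : g z ∈ Ioo a₁ (plusLevel n k)
      · constructor
        · intro h; exact absurd h (hIoo z hzo).2.ne
        · intro h; exact absurd h hzo.2.ne
      · rw [hout z hzo]
    · -- the old critical points other than `p` keep their values
      intro z hz hzp
      by_cases hj : morseIndex (𝓡∂ (n + 1)) g z = k
      · rw [hvP' z ⟨⟨hz, hj⟩, hzp⟩, hval z hz, hj]
      · refine hout z fun h => hj ?_
        rw [hval z hz] at h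
        exact (niceLevel_mem_Icc_lower_iff n k _).1 (Ioo_subset_Icc_self h)
  · -- `p` is the only critical point of index `k`: nothing to do
    have hP'e : P' = ∅ := not_nonempty_iff_eq_empty.1 hne
    refine ⟨g, a₁, hg.1, hξ, rfl, fun z _ => rfl, ha₁0, by rw [hpval]; exact ha₁L,
      by rw [hpval]; exact hLkVk, ?_, fun z => Iff.rfl, fun z _ _ => rfl⟩
    intro z hz hzp hzI
    rcases hslab z hz hzI with hzp' | hzP'
    · exact hzp (mem_singleton_iff.1 hzp')
    · rw [hP'e] at hzP'; exact hzP'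

end Cancel

end Summit.SmoothPoincare4.SmoothPoincare4.Theorems.AcyclicBisectionRigidity.Cancellation

end
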